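import Summits.CriticalPhenomena.CardyFormulaZ2.Theorems.CardyBoundaryCoulombGasHalfPlaneMarkDensityLawLisoAnti
import Summits.CriticalPhenomena.CardyFormulaZ2.Theorems.CardyBoundaryCoulombGasHalfPlaneMarkDensityLawLisoOfGlobal
import Summits.CriticalPhenomena.CardyFormulaZ2.Theorems.CardyBoundaryCoulombGasHalfPlaneMarkDensityLawGlobalEventProb
import Mathlib.Analysis.SpecialFunctions.Log.Basic

/-!
# The half-plane two-arm point LOWER bound for critical bond percolation on `ℤ²`
# (crux `HalfPlaneMarkDensityLaw`, stmt-CriticalPhenomena-5661, line `Sketch`; lead c12-0, assembly)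

`liso k R` (`…TwoArmPoint.lean`): `(k,0)` is joined inside the half-box `Λ⁺_R(k) = [k−R,k+R]×[0,R]` to its rim and no
vertex of `[k−R,k−1]×{0}` is joined to `(k,0)` inside the box — the primal "left-isolated arm" form of the half-plane
two-arm event at a boundary point (the local shadow of the crux's first-hit event: `firstHit ⊆ liso`,
`SymmDiff.leftIso_of_firstHit`).  The tree has W. Werner's UPPER bound `P(liso 0 R) ≤ C/R` (`stub_twoArmPoint`).
Here: **the matching LOWER bound** `c/R ≤ P(liso k R)`, `c/R ≤ P(riso k R)` for `R ≥ R₀` (`stub_lisoLowerBound`), its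
WINDOW form `c·m/R ≤ P(⋃_{u∈[j,j+m)} liso u R)` (`stub_lisoWindowLowerBound`), and the universal value of the half-plane
two-arm exponent in point form, `log P(liso 0 n)/log n → −1` (`stub_lisoExponent`) — W. Werner, *Lectures on
two-dimensional critical percolation* (PCMI 2007), Lecture 2, first exercise sheet, "Two-arm exponent in the half-plane",
parts 1 and 3, for BOND percolation on `ℤ²`, mirrored and in primal form (no duality is needed): with the shield "no open
left–right crossing of `[0,q]×[0,4q]`", an open top–bottom crossing of `[2q,4q]×[0,4q]` and an open left–right crossing of
`[2q,8q+1]×[0,4q]` (probability `≥ c₀`, `stub_globalEventProb`), the leftmost point `u ∈ [0,4q]` of the bottom row joined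
in the strip `[−4q,8q+1]×[0,4q]` to the column `8q+1` is left-isolated to distance `4q` (`stub_lisoOfGlobal`); all
`P(liso u (4q))` are equal (`TwoArm.real_liso_eq`), so `(4q+1)·P(liso 0 (4q)) ≥ c₀`; general radii by antitonicity
(`stub_lisoAnti`).
-/

noncomputable section

namespace Summit.CriticalPhenomena.CardyFormulaZ2.Cruxes.HalfPlaneMarkDensityLaw.SketchLine

open Literature.Probability.Percolation Literature.Probability.LatticeModels
open MeasureTheory Filter Set SimpleGraph
open scoped Topology
open Summit.CriticalPhenomena.CardyFormulaZ2.Theorems.HalfPlaneMarkDensityLaw.Negative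

namespace TwoArmLower

open TwoArm Literature.Probability.Percolation.Z2HalfPlane

/-! ### Radius `4q`: counting -/

/-- **Counting at radius `4q`**: `c₀ ≤ (4q+1) · P(liso 0 (4q))` for `q ≥ 2`, where `c₀` bounds the probability of the
global event from below. [cite: WernerPCMI2009, Lecture 2, first exercise sheet] -/
theorem le_mul_real_liso {c₀ : ℝ}
    (hc₀ : ∀ q : ℕ, 2 ≤ q →
      c₀ ≤ μ.real ((lrCrossing q (4 * q))ᶜ ∩
        (openCrossing ((· + (![2 * (q : ℤ), 0] : Site 2)) '' (↑(rectangle (2 * q) (4 * q)) : Set (Site 2)))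
            ((· + (![2 * (q : ℤ), 0] : Site 2)) '' (↑(bottomSide (2 * q) (4 * q)) : Set (Site 2)))
            ((· + (![2 * (q : ℤ), 0] : Site 2)) '' (↑(topSide (2 * q) (4 * q)) : Set (Site 2))) ∩
         openCrossing ((· + (![2 * (q : ℤ), 0] : Site 2)) '' (↑(rectangle (6 * q + 1) (4 * q)) : Set (Site 2)))
            ((· + (![2 * (q : ℤ), 0] : Site 2)) '' (↑(leftSide (6 * q + 1) (4 * q)) : Set (Site 2)))
            ((· + (![2 * (q : ℤ), 0] : Site 2)) '' (↑(rightSide (6 * q + 1) (4 * q)) : Set (Site 2))))))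
    (q : ℕ) (hq : 2 ≤ q) :
    c₀ ≤ (4 * (q : ℝ) + 1) * μ.real (liso 0 (4 * q)) := by
  classical
  set G := (lrCrossing q (4 * q))ᶜ ∩
        (openCrossing ((· + (![2 * (q : ℤ), 0] : Site 2)) '' (↑(rectangle (2 * q) (4 * q)) : Set (Site 2)))
            ((· + (![2 * (q : ℤ), 0] : Site 2)) '' (↑(bottomSide (2 * q) (4 * q)) : Set (Site 2)))
            ((· + (![2 * (q : ℤ), 0] : Site 2)) '' (↑(topSide (2 * q) (4 * q)) : Set (Site 2))) ∩
         openCrossing ((· + (![2 * (q : ℤ), 0] : Site 2)) '' (↑(rectangle (6 * q + 1) (4 * q)) : Set (Site 2)))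
            ((· + (![2 * (q : ℤ), 0] : Site 2)) '' (↑(leftSide (6 * q + 1) (4 * q)) : Set (Site 2)))
            ((· + (![2 * (q : ℤ), 0] : Site 2)) '' (↑(rightSide (6 * q + 1) (4 * q)) : Set (Site 2)))) with hG
  set I : Finset ℤ := Finset.Icc (0 : ℤ) (4 * q) with hI
  -- the global event lies (a.e.) in the union of the `liso u (4q)`, `u ∈ [0, 4q]`
  have hincl : ∀ᵐ ω ∂μ, ω ∈ G → ω ∈ ⋃ u ∈ I, liso u (4 * q) := by
    rw [mu_eq]
    filter_upwards [ae_subset_edgeSet (zdGraph 2) half] with ω hω hωG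
    obtain ⟨hD, hV, hH⟩ := hωG
    obtain ⟨u, hu0, hu1, hu⟩ := stub_lisoOfGlobal q (by omega) ω hω hD hV hH
    refine mem_iUnion₂.2 ⟨u, Finset.mem_Icc.2 ⟨hu0, hu1⟩, ?_⟩
    simpa [liso, hb, rim] using hu
  have h1 : μ.real G ≤ μ.real (⋃ u ∈ I, liso u (4 * q)) := by
    rw [measureReal_def, measureReal_def]
    exact ENNReal.toReal_mono (measure_ne_top _ _) (measure_mono_ae hincl)
  have h2 : μ.real (⋃ u ∈ I, liso u (4 * q)) ≤ ∑ u ∈ I, μ.real (liso u (4 * q)) :=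
    measureReal_biUnion_finset_le _ _
  have h3 : ∑ u ∈ I, μ.real (liso u (4 * q)) = (4 * (q : ℝ) + 1) * μ.real (liso 0 (4 * q)) := by
    rw [Finset.sum_congr rfl fun u _ => real_liso_eq u 0 (4 * q), Finset.sum_const, hI, Int.card_Icc,
      nsmul_eq_mul, show (4 * (q : ℤ) + 1 - 0).toNat = 4 * q + 1 by omega]
    push_cast
    ring
  calc c₀ ≤ μ.real G := hc₀ q hq
    _ ≤ μ.real (⋃ u ∈ I, liso u (4 * q)) := h1
    _ ≤ ∑ u ∈ I, μ.real (liso u (4 * q)) := h2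
    _ = (4 * (q : ℝ) + 1) * μ.real (liso 0 (4 * q)) := h3

/-! ### All radii: antitonicity -/

/-- `P(liso k R') ≤ P(liso k R)` for `R ≤ R'`. [folklore] -/
theorem real_liso_anti (k : ℤ) {R R' : ℕ} (hRR' : R ≤ R') : μ.real (liso k R') ≤ μ.real (liso k R) := by
  rw [measureReal_def, measureReal_def]
  refine ENNReal.toReal_mono (measure_ne_top _ _) (measure_mono_ae ?_)
  rw [mu_eq]
  filter_upwards [ae_subset_edgeSet (zdGraph 2) half] with ω hω h
  exact (stub_lisoAnti k R R' hRR' ω hω).1 h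

/-- **The point lower bound at the origin**: `c / R ≤ P(liso 0 R)` for `R ≥ 8`, with `c = c₀ / 2`. [cite: WernerPCMI2009, Lecture 2, first exercise sheet] -/
theorem div_le_real_liso_zero {c₀ : ℝ} (hc₀0 : 0 < c₀)
    (hc₀ : ∀ q : ℕ, 2 ≤ q → c₀ ≤ (4 * (q : ℝ) + 1) * μ.real (liso 0 (4 * q)))
    {R : ℕ} (hR : 8 ≤ R) : c₀ / 2 / R ≤ μ.real (liso 0 R) := by
  -- `q := ⌈R/4⌉`, so that `R ≤ 4q ≤ R + 3` and `q ≥ 2`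
  set q : ℕ := (R + 3) / 4 with hq
  have hq4 : R ≤ 4 * q := by omega
  have hq4' : 4 * q ≤ R + 3 := by omega
  have hq2 : 2 ≤ q := by omega
  have hkey := hc₀ q hq2
  have hanti : μ.real (liso 0 (4 * q)) ≤ μ.real (liso 0 R) := real_liso_anti 0 hq4
  have hR0 : (0 : ℝ) < R := by exact_mod_cast (by omega : 0 < R)
  have hq0 : (0 : ℝ) < 4 * (q : ℝ) + 1 := by positivity
  have hqR : 4 * (q : ℝ) + 1 ≤ 2 * R := by
    have : ((4 * q + 1 : ℕ) : ℝ) ≤ ((2 * R : ℕ) : ℝ) := by exact_mod_cast (by omega)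
    push_cast at this; linarith
  have h1 : c₀ / (4 * (q : ℝ) + 1) ≤ μ.real (liso 0 (4 * q)) := by
    rw [div_le_iff₀ hq0]; linarith [hkey]
  calc c₀ / 2 / R = c₀ / (2 * R) := by rw [div_div]
    _ ≤ c₀ / (4 * (q : ℝ) + 1) := div_le_div_of_nonneg_left hc₀0.le hq0 hqR
    _ ≤ μ.real (liso 0 (4 * q)) := h1
    _ ≤ μ.real (liso 0 R) := hanti

/-- **STUB 6 (registered signature): the half-plane two-arm point LOWER bound for bond-`ℤ²`**, both orientations,
uniformly in the base point. [cite: WernerPCMI2009, Lecture 2, first exercise sheet] -/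
theorem stub_lisoLowerBound :
    ∃ c : ℝ, 0 < c ∧ ∃ R₀ : ℕ, ∀ (k : ℤ) (R : ℕ), R₀ ≤ R →
      c / R ≤ μ.real (openCrossing {v : Site 2 | 0 ≤ v 1 ∧ v 1 ≤ (R : ℤ) ∧ k - R ≤ v 0 ∧ v 0 ≤ k + R} {bpt k}
              {v : Site 2 | v 0 = k - R ∨ v 0 = k + R ∨ v 1 = (R : ℤ)} \
            openCrossing {v : Site 2 | 0 ≤ v 1 ∧ v 1 ≤ (R : ℤ) ∧ k - R ≤ v 0 ∧ v 0 ≤ k + R}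
              (rowIcc (k - R) (k - 1)) {bpt k}) ∧
      c / R ≤ μ.real (openCrossing {v : Site 2 | 0 ≤ v 1 ∧ v 1 ≤ (R : ℤ) ∧ k - R ≤ v 0 ∧ v 0 ≤ k + R} {bpt k}
              {v : Site 2 | v 0 = k - R ∨ v 0 = k + R ∨ v 1 = (R : ℤ)} \
            openCrossing {v : Site 2 | 0 ≤ v 1 ∧ v 1 ≤ (R : ℤ) ∧ k - R ≤ v 0 ∧ v 0 ≤ k + R}
              (rowIcc (k + 1) (k + R)) {bpt k}) := by
  show ∃ c : ℝ, 0 < c ∧ ∃ R₀ : ℕ, ∀ (k : ℤ) (R : ℕ), R₀ ≤ R → c / R ≤ μ.real (liso k R) ∧ c / R ≤ μ.real (riso k R)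
  obtain ⟨c₀, hc₀0, hc₀⟩ := stub_globalEventProb
  refine ⟨c₀ / 2, by positivity, 8, fun k R hR => ?_⟩
  have h0 : c₀ / 2 / R ≤ μ.real (liso 0 R) :=
    div_le_real_liso_zero hc₀0 (fun q hq => le_mul_real_liso hc₀ q hq) hR
  exact ⟨by rwa [real_liso_eq k 0 R], by rwa [real_riso_eq, real_liso_eq (-k) 0 R]⟩

/-! ### The window form -/

/-- Translation invariance of the window union: `P(⋃_{u∈[j,j+m)} liso u R) = P(⋃_{u∈[0,m)} liso u R)`. [folklore] -/
theorem real_window_eq (j : ℤ) (m R : ℕ) :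
    μ.real (⋃ u ∈ Finset.Ico j (j + m), liso u R) = μ.real (⋃ u ∈ Finset.Ico (0 : ℤ) (0 + m), liso u R) := by
  have hset : (⋃ u ∈ Finset.Ico j (j + m), liso u R) =
      BondConfig.relabel (sym2Equiv (Site.shift (hvec (-j)))) ⁻¹' (⋃ u ∈ Finset.Ico (0 : ℤ) (0 + m), liso u R) := by
    ext ω
    simp only [mem_preimage, mem_iUnion, Finset.mem_Ico, exists_prop]
    constructor
    · rintro ⟨u, hu, hω⟩
      refine ⟨u - j, by omega, ?_⟩
      have h := preimage_relabel_shift_liso (u - j) (-j) R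
      rw [show u - j + -j = u - j - j by ring] at h
      -- use the shift identity at base point `u`: `relabel(shift (-j))⁻¹' liso (u + -j) R = liso u R`
      have h' := preimage_relabel_shift_liso u (-j) R
      rw [show u + -j = u - j by ring] at h'
      rw [← h'] at hω
      exact hω
    · rintro ⟨u, hu, hω⟩
      refine ⟨u + j, by omega, ?_⟩
      have h' := preimage_relabel_shift_liso (u + j) (-j) R
      rw [show u + j + -j = u by ring] at h'
      rw [← h']
      exact hω
  rw [hset, mu_eq, bondPercolation_real_preimage_shift]

/-- **Counting over windows at radius `4q`**: for `q ≥ 2` and `1 ≤ m`,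
`c₀ ≤ ((4q)/m + 1) · P(⋃_{u∈[0,m)} liso u (4q))`. [cite: WernerPCMI2009, Lecture 2, first exercise sheet] -/
theorem le_mul_real_window {c₀ : ℝ}
    (hc₀ : ∀ q : ℕ, 2 ≤ q →
      c₀ ≤ μ.real ((lrCrossing q (4 * q))ᶜ ∩
        (openCrossing ((· + (![2 * (q : ℤ), 0] : Site 2)) '' (↑(rectangle (2 * q) (4 * q)) : Set (Site 2)))
            ((· + (![2 * (q : ℤ), 0] : Site 2)) '' (↑(bottomSide (2 * q) (4 * q)) : Set (Site 2)))
            ((· + (![2 * (q : ℤ), 0] : Site 2)) '' (↑(topSide (2 * q) (4 * q)) : Set (Site 2))) ∩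
         openCrossing ((· + (![2 * (q : ℤ), 0] : Site 2)) '' (↑(rectangle (6 * q + 1) (4 * q)) : Set (Site 2)))
            ((· + (![2 * (q : ℤ), 0] : Site 2)) '' (↑(leftSide (6 * q + 1) (4 * q)) : Set (Site 2)))
            ((· + (![2 * (q : ℤ), 0] : Site 2)) '' (↑(rightSide (6 * q + 1) (4 * q)) : Set (Site 2))))))
    (q : ℕ) (hq : 2 ≤ q) {m : ℕ} (hm : 1 ≤ m) :
    c₀ ≤ (((4 * q) / m + 1 : ℕ) : ℝ) * μ.real (⋃ u ∈ Finset.Ico (0 : ℤ) (0 + m), liso u (4 * q)) := by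
  classical
  set G := (lrCrossing q (4 * q))ᶜ ∩
        (openCrossing ((· + (![2 * (q : ℤ), 0] : Site 2)) '' (↑(rectangle (2 * q) (4 * q)) : Set (Site 2)))
            ((· + (![2 * (q : ℤ), 0] : Site 2)) '' (↑(bottomSide (2 * q) (4 * q)) : Set (Site 2)))
            ((· + (![2 * (q : ℤ), 0] : Site 2)) '' (↑(topSide (2 * q) (4 * q)) : Set (Site 2))) ∩
         openCrossing ((· + (![2 * (q : ℤ), 0] : Site 2)) '' (↑(rectangle (6 * q + 1) (4 * q)) : Set (Site 2)))
            ((· + (![2 * (q : ℤ), 0] : Site 2)) '' (↑(leftSide (6 * q + 1) (4 * q)) : Set (Site 2)))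
            ((· + (![2 * (q : ℤ), 0] : Site 2)) '' (↑(rightSide (6 * q + 1) (4 * q)) : Set (Site 2)))) with hG
  set N : ℕ := (4 * q) / m + 1 with hN
  -- window `i` is `[i m, i m + m)`
  set W : ℕ → Set (BondConfig (Site 2)) := fun i => ⋃ u ∈ Finset.Ico ((i : ℤ) * m) ((i : ℤ) * m + m), liso u (4 * q)
    with hW
  have hNm : 4 * q < N * m := by
    rw [hN]
    have := Nat.lt_div_mul_add (a := 4 * q) hm
    nlinarith
  -- the global event lies (a.e.) in the union of the windows
  have hincl : ∀ᵐ ω ∂μ, ω ∈ G → ω ∈ ⋃ i ∈ Finset.range N, W i := by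
    rw [mu_eq]
    filter_upwards [ae_subset_edgeSet (zdGraph 2) half] with ω hω hωG
    obtain ⟨hD, hV, hH⟩ := hωG
    obtain ⟨u, hu0, hu1, hu⟩ := stub_lisoOfGlobal q (by omega) ω hω hD hV hH
    have hu' : ω ∈ liso u (4 * q) := by simpa [liso, hb, rim] using hu
    -- `u ∈ [i m, i m + m)` for `i = u / m`
    obtain ⟨n, rfl⟩ : ∃ n : ℕ, u = n := ⟨u.toNat, (Int.toNat_of_nonneg hu0).symm⟩
    have hn4 : n ≤ 4 * q := by exact_mod_cast hu1
    have him : n / m * m ≤ n := Nat.div_mul_le_self n m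
    have him' : n < n / m * m + m := Nat.lt_div_mul_add hm
    have hiN : n / m < N := by
      by_contra hge
      push Not at hge
      have : N * m ≤ n / m * m := Nat.mul_le_mul_right m hge
      omega
    refine mem_iUnion₂.2 ⟨n / m, Finset.mem_range.2 hiN, ?_⟩
    refine mem_iUnion₂.2 ⟨(n : ℤ), Finset.mem_Ico.2 ⟨by exact_mod_cast him, by exact_mod_cast him'⟩, hu'⟩
  have h1 : μ.real G ≤ μ.real (⋃ i ∈ Finset.range N, W i) := by
    rw [measureReal_def, measureReal_def]
    exact ENNReal.toReal_mono (measure_ne_top _ _) (measure_mono_ae hincl)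
  have h2 : μ.real (⋃ i ∈ Finset.range N, W i) ≤ ∑ i ∈ Finset.range N, μ.real (W i) :=
    measureReal_biUnion_finset_le _ _
  have h3 : ∑ i ∈ Finset.range N, μ.real (W i) = (N : ℝ) * μ.real (⋃ u ∈ Finset.Ico (0 : ℤ) (0 + m), liso u (4 * q)) := by
    have hWi : ∀ i ∈ Finset.range N, μ.real (W i) = μ.real (⋃ u ∈ Finset.Ico (0 : ℤ) (0 + m), liso u (4 * q)) :=
      fun i _ => real_window_eq ((i : ℤ) * m) m (4 * q)
    rw [Finset.sum_congr rfl hWi, Finset.sum_const, Finset.card_range, nsmul_eq_mul]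
  calc c₀ ≤ μ.real G := hc₀ q hq
    _ ≤ μ.real (⋃ i ∈ Finset.range N, W i) := h1
    _ ≤ ∑ i ∈ Finset.range N, μ.real (W i) := h2
    _ = (N : ℝ) * μ.real (⋃ u ∈ Finset.Ico (0 : ℤ) (0 + m), liso u (4 * q)) := h3

/-- The window union is antitone in the radius (in probability). [folklore] -/
theorem real_window_anti (j : ℤ) (m : ℕ) {R R' : ℕ} (hRR' : R ≤ R') :
    μ.real (⋃ u ∈ Finset.Ico j (j + m), liso u R') ≤ μ.real (⋃ u ∈ Finset.Ico j (j + m), liso u R) := by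
  rw [measureReal_def, measureReal_def]
  refine ENNReal.toReal_mono (measure_ne_top _ _) (measure_mono_ae ?_)
  rw [mu_eq]
  filter_upwards [ae_subset_edgeSet (zdGraph 2) half] with ω hω h
  obtain ⟨u, hu, hωu⟩ := mem_iUnion₂.1 h
  exact mem_iUnion₂.2 ⟨u, hu, (stub_lisoAnti u R R' hRR' ω hω).1 hωu⟩

/-- **STUB 7 (registered signature): the WINDOW lower bound** — with probability `≥ c·m/R` some point of a
boundary window of `m ≤ R` sites carries a left-isolated arm to distance `R` (`R ≥ R₀`). [cite: WernerPCMI2009, Lecture 2, first exercise sheet] -/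
theorem stub_lisoWindowLowerBound :
    ∃ c : ℝ, 0 < c ∧ ∃ R₀ : ℕ, ∀ R : ℕ, R₀ ≤ R → ∀ m : ℕ, 1 ≤ m → m ≤ R → ∀ j : ℤ,
      c * m / R ≤ μ.real (⋃ u ∈ Finset.Ico j (j + m), (openCrossing {v : Site 2 | 0 ≤ v 1 ∧ v 1 ≤ (R : ℤ) ∧ u - R ≤ v 0 ∧ v 0 ≤ u + R} {bpt u}
              {v : Site 2 | v 0 = u - R ∨ v 0 = u + R ∨ v 1 = (R : ℤ)} \
            openCrossing {v : Site 2 | 0 ≤ v 1 ∧ v 1 ≤ (R : ℤ) ∧ u - R ≤ v 0 ∧ v 0 ≤ u + R}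
              (rowIcc (u - R) (u - 1)) {bpt u})) := by
  show ∃ c : ℝ, 0 < c ∧ ∃ R₀ : ℕ, ∀ R : ℕ, R₀ ≤ R → ∀ m : ℕ, 1 ≤ m → m ≤ R → ∀ j : ℤ,
      c * m / R ≤ μ.real (⋃ u ∈ Finset.Ico j (j + m), liso u R)
  obtain ⟨c₀, hc₀0, hc₀⟩ := stub_globalEventProb
  refine ⟨c₀ / 3, by positivity, 8, fun R hR m hm hmR j => ?_⟩
  set q : ℕ := (R + 3) / 4 with hq
  have hq4 : R ≤ 4 * q := by omega
  have hq4' : 4 * q ≤ R + 3 := by omega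
  have hq2 : 2 ≤ q := by omega
  have hkey := le_mul_real_window hc₀ q hq2 hm
  set N : ℕ := (4 * q) / m + 1 with hN
  have hN0 : (0 : ℝ) < N := by positivity
  have hR0 : (0 : ℝ) < R := by exact_mod_cast (by omega : 0 < R)
  have hm0 : (0 : ℝ) < m := by exact_mod_cast hm
  -- `N m ≤ 4q + m ≤ 2R + 3 ≤ 3R`
  have hNm : (N : ℝ) * m ≤ 3 * R := by
    have h1 : N * m ≤ 4 * q + m := by
      rw [hN, Nat.add_mul, one_mul]
      exact Nat.add_le_add_right (Nat.div_mul_le_self _ _) _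
    have h2 : ((N * m : ℕ) : ℝ) ≤ ((3 * R : ℕ) : ℝ) := by exact_mod_cast (by omega)
    push_cast at h2
    exact h2
  have hwin : c₀ / N ≤ μ.real (⋃ u ∈ Finset.Ico (0 : ℤ) (0 + m), liso u (4 * q)) := by
    rw [div_le_iff₀ hN0]; linarith [hkey]
  calc c₀ / 3 * m / R = c₀ / (3 * R / m) := by field_simp
    _ ≤ c₀ / N := by
        refine div_le_div_of_nonneg_left hc₀0.le hN0 ?_
        rw [le_div_iff₀ hm0]; exact hNm
    _ ≤ μ.real (⋃ u ∈ Finset.Ico (0 : ℤ) (0 + m), liso u (4 * q)) := hwin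
    _ = μ.real (⋃ u ∈ Finset.Ico j (j + m), liso u (4 * q)) := (real_window_eq j m (4 * q)).symm
    _ ≤ μ.real (⋃ u ∈ Finset.Ico j (j + m), liso u R) := real_window_anti j m hq4

/-! ### The exponent -/

/-- **STUB 8 (registered signature): the half-plane two-arm exponent of bond-`ℤ²` is `1`** (point form):
`log P(liso 0 n) / log n → −1`, from `c/n ≤ P(liso 0 n) ≤ C/n`. [cite: WernerPCMI2009, Lecture 2, first exercise sheet] -/
theorem stub_lisoExponent :
    Tendsto (fun n : ℕ ↦ Real.log (μ.real (openCrossing {v : Site 2 | 0 ≤ v 1 ∧ v 1 ≤ (n : ℤ) ∧ (0 : ℤ) - n ≤ v 0 ∧ v 0 ≤ (0 : ℤ) + n} {bpt (0 : ℤ)}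
              {v : Site 2 | v 0 = (0 : ℤ) - n ∨ v 0 = (0 : ℤ) + n ∨ v 1 = (n : ℤ)} \
            openCrossing {v : Site 2 | 0 ≤ v 1 ∧ v 1 ≤ (n : ℤ) ∧ (0 : ℤ) - n ≤ v 0 ∧ v 0 ≤ (0 : ℤ) + n}
              (rowIcc ((0 : ℤ) - n) ((0 : ℤ) - 1)) {bpt (0 : ℤ)})) / Real.log n) atTop (𝓝 (-1)) := by
  show Tendsto (fun n : ℕ ↦ Real.log (μ.real (liso 0 n)) / Real.log n) atTop (𝓝 (-1))
  obtain ⟨c, hc0, R₀, hlow⟩ := stub_lisoLowerBound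
  obtain ⟨C, hup⟩ := real_liso_zero_le
  have hlog : Tendsto (fun n : ℕ ↦ Real.log (n : ℝ)) atTop atTop :=
    Real.tendsto_log_atTop.comp tendsto_natCast_atTop_atTop
  set M : ℝ := max |Real.log c| |Real.log C| with hM
  -- eventually `|log P_n / log n + 1| = |log (n P_n)| / log n ≤ M / log n`
  have hev : ∀ᶠ n : ℕ in atTop,
      ‖Real.log (μ.real (liso 0 n)) / Real.log n + 1‖ ≤ M / Real.log n := by
    filter_upwards [eventually_ge_atTop (max R₀ 2)] with n hn
    have hnR₀ : R₀ ≤ n := le_trans (le_max_left _ _) hn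
    have hn2 : 2 ≤ n := le_trans (le_max_right _ _) hn
    have hn0 : (0 : ℝ) < n := by exact_mod_cast (by omega : 0 < n)
    have hlogn : 0 < Real.log n := Real.log_pos (by exact_mod_cast (by omega : 1 < n))
    set P := μ.real (liso 0 n) with hP
    have hlo : c / n ≤ P := (hlow 0 n hnR₀).1
    have hhi : P ≤ C / n := hup n (by omega)
    have hP0 : 0 < P := lt_of_lt_of_le (by positivity) hlo
    have hnP_lo : c ≤ n * P := by rwa [div_le_iff₀ hn0, mul_comm] at hlo
    have hnP_hi : n * P ≤ C := by rwa [le_div_iff₀ hn0, mul_comm] at hhi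
    have hlogc : Real.log c ≤ Real.log (n * P) := Real.log_le_log hc0 hnP_lo
    have hlogC : Real.log (n * P) ≤ Real.log C := Real.log_le_log (by positivity) hnP_hi
    have habs : |Real.log (n * P)| ≤ M := by
      rw [hM, abs_le]
      constructor
      · have := neg_abs_le (Real.log c)
        have := le_max_left |Real.log c| |Real.log C|
        linarith
      · have := le_abs_self (Real.log C)
        have := le_max_right |Real.log c| |Real.log C|
        linarith
    have hid : Real.log P / Real.log n + 1 = Real.log (n * P) / Real.log n := by
      rw [Real.log_mul hn0.ne' hP0.ne']
      field_simp
      ring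
    rw [hid, Real.norm_eq_abs, abs_div, abs_of_pos hlogn]
    exact div_le_div_of_nonneg_right habs hlogn.le
  have hbound : Tendsto (fun n : ℕ ↦ M / Real.log n) atTop (𝓝 0) := tendsto_const_nhds.div_atTop hlog
  have h0 : Tendsto (fun n : ℕ ↦ Real.log (μ.real (liso 0 n)) / Real.log n + 1) atTop (𝓝 0) :=
    squeeze_zero_norm' hev hbound
  have := h0.add_const (-1)
  simpa using this

end TwoArmLower

end Summit.CriticalPhenomena.CardyFormulaZ2.Cruxes.HalfPlaneMarkDensityLaw.SketchLine
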